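import Summits.CriticalPhenomena.PercolationContinuityZ3.Theorems.PercNearOneGluingNoHeavyQuantSecondWeightOdds
import HarnessLib

/-!
# QUANT lane R8 — second occurring weight of independent items (II): Lemma T′, affinity, and THE SINGLES CHAIN LEMMA

builds on p205010 (kernel theorem, internal audit signed; external expert review pending)

Support file (`--supports stmt-CriticalPhenomena-4575`), QUANT lane lead (gen 8), rung R8 of
`run/shared/lean/prim/quant/LADDER.md`; memo `prim-quant-lead-g7/LEAD-NOTES-G7.md` N16 (6), N17 Step 2c.  Continues
`…QuantSecondWeightOdds.lean` (same local notations: items `(w, p)`, `EFS[L, x] = (E W, E F)`, `zS`, `σS`, `Adm`); adds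
`GZ[L] = (G, ZS)` with `G = Σ_{j ≤ |L|} P(exactly one of the first j items occurs)`, `ZS = Σ_{j ≤ |L|} P(none of the first j occurs)`.
Pure real algebra on lists; no definitions, no sorries, standard axioms.

* `Quant.SecondWeight.gz_tprime` — **Lemma T′**: probabilities `p_i ∈ [x, 1]` give `G ≥ min(1, |L|·x)` (induction conditioning on the first
  item; four elementary cases, `tprime_step`);  `EFS_tied` — for an all-TIED list (`w p = x`) `E W = x·G`, `F = x·ZS`.
* `Quant.SecondWeight.EFS_affine` — `E W`, `F` are affine in each single probability;  `affine_nonneg_of_endpoints`.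
* `Quant.SecondWeight.secondWeight_singles` — **THE SINGLES CHAIN LEMMA**: admissible items (`0 ≤ p ≤ 1`, `w ≤ 1`, `x ≤ w p`, `x > 0`) give
  `E W ≥ x · min(1, Σ w p)`.  Proof (N17 Step 2c, `scl_aux`): with a frozen prefix of TIED or SURE items, the first free probability is moved
  along the affine `E W − x·σS` to tied (`p = x/w`) or sure (`p = 1`) unless `σS = 1` is met first, where the regime-`σ ≥ 1` bound
  `ew_ge_of_sigma_ge_one` applies; the all-frozen base is (E0) (a sure item) or Lemma T′ (all tied, `σS = |L| x`).
This is the elementary core of "FAR holds at layer one on every tree" (`…QuantSecondWeightLevels.lean`, `…QuantFarTreeMultiCompanion.lean`).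
Exact numerical re-check: lead g8 `work/explore/check_abstract.py` (0 violations); lead g7 `explore/scl_test.py` (30 000 instances). [this work]
-/

namespace Summit.CriticalPhenomena.PercolationContinuityZ3.Theorems

namespace Quant

namespace SecondWeight

open Finset

/-- `zS[L] = ∏_{(w,p) ∈ L} (1 − p)`: no item occurs. -/
local notation3 "zS[" L "]" => (List.foldr (fun (l : ℝ × ℝ) (acc : ℝ) => (1 - l.2) * acc) (1 : ℝ) L)
/-- `EFS[L, x] = (E W, E F)`: expected second occurring weight (`x` if exactly one, `0` if none) and expected first occurring weight (`x` if none). -/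
local notation3 "EFS[" L ", " x "]" =>
  (List.foldr (fun (l : ℝ × ℝ) (acc : ℝ × ℝ) => (l.2 * acc.2 + (1 - l.2) * acc.1, l.1 * l.2 + (1 - l.2) * acc.2)) ((0 : ℝ), (x : ℝ)) L)
/-- `σS[L] = Σ w p`: expected total occurring weight. -/
local notation3 "σS[" L "]" => (List.sum (List.map (fun (l : ℝ × ℝ) => l.1 * l.2) L))
/-- `GZ[L] = (G, ZS)`: `G = Σ_j P(exactly one among the first j)`, `ZS = Σ_j P(none among the first j)` (`j = 0, …, |L|`). -/
local notation3 "GZ[" L "]" =>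
  (List.foldr (fun (l : ℝ × ℝ) (acc : ℝ × ℝ) => (l.2 * acc.2 + (1 - l.2) * acc.1, 1 + (1 - l.2) * acc.2)) ((0 : ℝ), (1 : ℝ)) L)
/-- admissible item at level `x`: `0 ≤ p ≤ 1`, `w ≤ 1`, `x ≤ w p`. -/
local notation3 "Adm[" x ", " l "]" => (0 ≤ (l : ℝ × ℝ).2 ∧ (l : ℝ × ℝ).2 ≤ 1 ∧ (l : ℝ × ℝ).1 ≤ 1 ∧ (x : ℝ) ≤ (l : ℝ × ℝ).1 * (l : ℝ × ℝ).2)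

variable {x : ℝ}

/-- `GZ` of a cons. -/
theorem GZ_cons (l : ℝ × ℝ) (L : List (ℝ × ℝ)) :
    GZ[l :: L] = (l.2 * (GZ[L]).2 + (1 - l.2) * (GZ[L]).1, 1 + (1 - l.2) * (GZ[L]).2) := rfl
/-! ### Lemma T′ (all items tied) -/

/-- `ZS ≥ 1`, `ZS ≥ 1 + |L|·zS`, `G ≥ 1 − zS`, for probabilities in `[0,1]`. [this work] -/
theorem GZ_bounds (L : List (ℝ × ℝ)) (hL : ∀ l ∈ L, 0 ≤ l.2 ∧ l.2 ≤ 1) :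
    1 ≤ (GZ[L]).2 ∧ 1 + (L.length : ℝ) * zS[L] ≤ (GZ[L]).2 ∧ 1 - zS[L] ≤ (GZ[L]).1 := by
  induction L with
  | nil => simp
  | cons l L ih =>
    have hl := hL l (by simp)
    have hL' : ∀ l' ∈ L, 0 ≤ l'.2 ∧ l'.2 ≤ 1 := fun l' hl' => hL l' (by simp [hl'])
    obtain ⟨h1, h2, h3⟩ := ih hL'
    have hz := zS_bounds L hL'
    rw [GZ_cons, zS_cons, List.length_cons]
    push_cast
    refine ⟨?_, ?_, ?_⟩
    · show 1 ≤ 1 + (1 - l.2) * (GZ[L]).2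
      nlinarith
    · show 1 + ((L.length : ℝ) + 1) * ((1 - l.2) * zS[L]) ≤ 1 + (1 - l.2) * (GZ[L]).2
      have hlen : (0 : ℝ) ≤ L.length := Nat.cast_nonneg _
      nlinarith [mul_nonneg hlen hz.1, hz.2, hl.1, hl.2, mul_le_mul_of_nonneg_left h2 (by linarith : 0 ≤ 1 - l.2)]
    · show 1 - (1 - l.2) * zS[L] ≤ l.2 * (GZ[L]).2 + (1 - l.2) * (GZ[L]).1
      nlinarith [hl.1, hl.2]

/-- Real-arithmetic core of the induction step of Lemma T′. [this work] -/
theorem tprime_step (x p z G ZS : ℝ) (K : ℕ) (hx0 : 0 ≤ x) (hxp : x ≤ p) (hp1 : p ≤ 1) (hz0 : 0 ≤ z)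
    (hZS : 1 + K * z ≤ ZS) (hG1 : 1 - z ≤ G) (hG2 : min 1 (K * x) ≤ G) :
    min 1 (((K : ℝ) + 1) * x) ≤ p * ZS + (1 - p) * G := by
  have hK : (0 : ℝ) ≤ K := Nat.cast_nonneg K
  have hp0 : 0 ≤ p := le_trans hx0 hxp
  have hRHS : p * (1 + K * z) + (1 - p) * G ≤ p * ZS + (1 - p) * G := by nlinarith
  refine le_trans ?_ hRHS
  by_cases hA : ((K : ℝ) + 1) * x ≤ 1
  · rw [min_eq_right hA]
    have hKx : (K : ℝ) * x ≤ 1 := by nlinarith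
    by_cases hA1 : (K : ℝ) * x ≤ 1 - z
    · -- use `G ≥ 1 − z`
      by_cases hpk : 1 ≤ p * (K + 1)
      · nlinarith [mul_nonneg hz0 (by linarith : 0 ≤ p * (K + 1) - 1)]
      · push Not at hpk
        nlinarith [mul_nonneg (by linarith : 0 ≤ 1 - K * x - z) (by linarith : 0 ≤ 1 - p * (K + 1)),
          mul_nonneg (by linarith : 0 ≤ p - x) (by linarith : 0 ≤ 1 - K * x),
          mul_nonneg (mul_nonneg hK hx0) (by linarith : 0 ≤ 1 - (K + 1) * x)]
    · -- use `G ≥ K x`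
      push Not at hA1
      rw [min_eq_right hKx] at hG2
      nlinarith [mul_nonneg (mul_nonneg hp0 hK) (by linarith : 0 ≤ z - (1 - K * x)),
        mul_nonneg (by linarith : 0 ≤ p - x) (mul_nonneg (by linarith : (0 : ℝ) ≤ K + 1) (by linarith : 0 ≤ 1 - K * x)),
        mul_nonneg (mul_nonneg hK hx0) (by linarith : 0 ≤ 1 - (K + 1) * x)]
  · push Not at hA
    rw [min_eq_left hA.le]
    by_cases hB0 : 1 ≤ (K : ℝ) * x
    · rw [min_eq_left hB0] at hG2
      nlinarith [mul_nonneg hp0 (mul_nonneg hK hz0)]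
    · push Not at hB0
      rw [min_eq_right hB0.le] at hG2
      by_cases hB1 : (K : ℝ) * x ≤ 1 - z
      · nlinarith [mul_nonneg hz0 (by nlinarith : 0 ≤ p * (K + 1) - 1)]
      · push Not at hB1
        nlinarith [mul_nonneg (mul_nonneg hp0 hK) (by linarith : 0 ≤ z - (1 - K * x)),
          mul_nonneg (by linarith : 0 ≤ p - x) (mul_nonneg (by linarith : (0 : ℝ) ≤ K + 1) (by linarith : 0 ≤ 1 - K * x)),
          mul_nonneg (by linarith : 0 ≤ (K + 1) * x - 1) (by linarith : 0 ≤ 1 - K * x)]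

/-- **Lemma T′.**  For a list of probabilities `p_i ∈ [x, 1]` (`x ≥ 0`):  `G = Σ_{j=1}^{|L|} P(exactly one of the first j items occurs) ≥ min(1, |L|·x)`.
Induction on the list, conditioning on the first item: given it occurs the count is `ZS(tail) ≥ 1 + |tail|·zS(tail)`, otherwise it is
`G(tail) ≥ max(min(1, |tail| x), 1 − zS(tail))`; four elementary cases (`tprime_step`). [this work] -/
theorem gz_tprime (hx : 0 ≤ x) (L : List (ℝ × ℝ)) (hL : ∀ l ∈ L, x ≤ l.2 ∧ l.2 ≤ 1) :
    min 1 ((L.length : ℝ) * x) ≤ (GZ[L]).1 := by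
  induction L with
  | nil => simp
  | cons l L ih =>
    have hl := hL l (by simp)
    have hL' : ∀ l' ∈ L, x ≤ l'.2 ∧ l'.2 ≤ 1 := fun l' hl' => hL l' (by simp [hl'])
    have hL0 : ∀ l' ∈ L, 0 ≤ l'.2 ∧ l'.2 ≤ 1 := fun l' hl' => ⟨le_trans hx (hL' l' hl').1, (hL' l' hl').2⟩
    obtain ⟨_, h2, h3⟩ := GZ_bounds L hL0
    have hz := zS_bounds L hL0
    rw [GZ_cons, List.length_cons]
    push_cast
    exact tprime_step x l.2 zS[L] (GZ[L]).1 (GZ[L]).2 L.length hx hl.1 hl.2 hz.1 h2 h3 (ih hL')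

/-- For an all-TIED list (`w p = x` for every item): `E W = x·G` and `F = x·ZS`. [this work] -/
theorem EFS_tied (L : List (ℝ × ℝ)) (hL : ∀ l ∈ L, l.1 * l.2 = x) :
    (EFS[L, x]).1 = x * (GZ[L]).1 ∧ (EFS[L, x]).2 = x * (GZ[L]).2 := by
  induction L with
  | nil => simp
  | cons l L ih =>
    have hl := hL l (by simp)
    obtain ⟨h1, h2⟩ := ih (fun l' hl' => hL l' (by simp [hl']))
    rw [EFS_cons, GZ_cons]
    constructor
    · show l.2 * (EFS[L, x]).2 + (1 - l.2) * (EFS[L, x]).1 = x * (l.2 * (GZ[L]).2 + (1 - l.2) * (GZ[L]).1)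
      rw [h1, h2]; ring
    · show l.1 * l.2 + (1 - l.2) * (EFS[L, x]).2 = x * (1 + (1 - l.2) * (GZ[L]).2)
      rw [hl, h2]; ring

/-- For an all-tied list `σS = |L|·x`. [this work] -/
theorem σS_tied (L : List (ℝ × ℝ)) (hL : ∀ l ∈ L, l.1 * l.2 = x) : σS[L] = (L.length : ℝ) * x := by
  induction L with
  | nil => simp
  | cons l L ih =>
    rw [σS_cons, hL l (by simp), ih (fun l' hl' => hL l' (by simp [hl'])), List.length_cons]
    push_cast
    ring

/-! ### Affinity in one probability and the convexity reduction (N17 Step 2c) -/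

/-- `E W` and `F` are affine in the probability of any one item (the other items fixed). [this work] -/
theorem EFS_affine (T M : List (ℝ × ℝ)) (w x : ℝ) :
    ∃ α β γ δ : ℝ, ∀ t : ℝ, EFS[T ++ (w, t) :: M, x] = (α + β * t, γ + δ * t) := by
  induction T with
  | nil =>
    refine ⟨(EFS[M, x]).1, (EFS[M, x]).2 - (EFS[M, x]).1, (EFS[M, x]).2, w - (EFS[M, x]).2, fun t => ?_⟩
    rw [List.nil_append, EFS_cons]
    ext <;> simp only <;> ring
  | cons l T ih =>
    obtain ⟨α, β, γ, δ, h⟩ := ih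
    refine ⟨l.2 * γ + (1 - l.2) * α, l.2 * δ + (1 - l.2) * β, l.1 * l.2 + (1 - l.2) * γ, (1 - l.2) * δ, fun t => ?_⟩
    rw [List.cons_append, EFS_cons, h t]
    ext <;> simp only <;> ring

/-- An affine function nonnegative at the ends of an interval is nonnegative on it. [folklore] -/
theorem affine_nonneg_of_endpoints {f : ℝ → ℝ} (hf : ∃ α β : ℝ, ∀ t, f t = α + β * t) {lo hi p : ℝ}
    (hlo : lo ≤ p) (hhi : p ≤ hi) (h1 : 0 ≤ f lo) (h2 : 0 ≤ f hi) : 0 ≤ f p := by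
  obtain ⟨α, β, hf⟩ := hf
  rw [hf] at h1 h2 ⊢
  rcases le_or_gt 0 β with hβ | hβ
  · nlinarith [mul_le_mul_of_nonneg_left hlo hβ]
  · nlinarith [mul_le_mul_of_nonpos_left hhi hβ.le]

/-- The convexity induction: a prefix `T` of TIED (`w p = x`) or SURE (`p = 1`) admissible items followed by arbitrary admissible items `M`
satisfies `E W ≥ x·min(1, σS)`.  Induction on `M`: the first free item is pushed to tied or sure along the affine `E W − x σS` unless
`σS = 1` is met, where `ew_ge_of_sigma_ge_one` applies; the all-frozen base is Lemma T′ (`EFS_tied`, `gz_tprime`) or (E0). [this work] -/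
theorem scl_aux (hx : 0 < x) (M : List (ℝ × ℝ)) :
    ∀ T : List (ℝ × ℝ), (∀ l ∈ T, Adm[x, l] ∧ (l.1 * l.2 = x ∨ l.2 = 1)) → (∀ l ∈ M, Adm[x, l]) →
      x * min 1 σS[T ++ M] ≤ (EFS[T ++ M, x]).1 := by
  induction M with
  | nil =>
    intro T hT _
    rw [List.append_nil]
    have hT0 : ∀ l ∈ T, 0 ≤ l.2 ∧ l.2 ≤ 1 ∧ x ≤ l.1 :=
      fun l hl => ⟨(hT l hl).1.1, (hT l hl).1.2.1, (adm_bounds hx (hT l hl).1).2.1⟩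
    by_cases hsure : ∃ l ∈ T, l.2 = 1
    · obtain ⟨l, hl, hp⟩ := hsure
      have h0 := ew_ge_x_mul hx.le T hT0
      rw [zS_eq_zero_of_mem T hl hp] at h0
      have : x * min 1 σS[T] ≤ x * 1 := mul_le_mul_of_nonneg_left (min_le_left _ _) hx.le
      linarith
    · push Not at hsure
      have htied : ∀ l ∈ T, l.1 * l.2 = x := fun l hl => (hT l hl).2.resolve_right (hsure l hl)
      rw [(EFS_tied T htied).1, σS_tied T htied]
      refine mul_le_mul_of_nonneg_left (gz_tprime hx.le T fun l hl => ?_) hx.le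
      exact ⟨(adm_bounds hx (hT l hl).1).2.2, (hT l hl).1.2.1⟩
  | cons l M ih =>
    intro T hT hM
    obtain ⟨w, p⟩ := l
    have hadm : Adm[x, (w, p)] := hM (w, p) (by simp)
    have hM' : ∀ l' ∈ M, Adm[x, l'] := fun l' hl' => hM l' (by simp [hl'])
    obtain ⟨hw0, hxw, hxp⟩ := adm_bounds hx hadm
    obtain ⟨hp0, hp1, hw1, hwp⟩ := hadm
    simp only at hw0 hxw hxp hp0 hp1 hw1 hwp
    -- `σS` along the family `t ↦ T ++ (w,t) :: M`
    have hσt : ∀ t : ℝ, σS[T ++ (w, t) :: M] = σS[T] + σS[M] + w * t := by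
      intro t; rw [σS_append, σS_cons]; ring
    set σ₀ : ℝ := σS[T] + σS[M] with hσ₀
    -- admissibility of the whole list for any admissible value of the free item
    have hall : ∀ t : ℝ, 0 ≤ t → t ≤ 1 → x ≤ w * t → ∀ l' ∈ T ++ (w, t) :: M, Adm[x, l'] := by
      intro t ht0 ht1 hxt l' hl'
      rw [List.mem_append, List.mem_cons] at hl'
      rcases hl' with h | rfl | h
      · exact (hT l' h).1
      · exact ⟨ht0, ht1, hw1, hxt⟩
      · exact hM' l' h
    by_cases hbig : 1 ≤ σ₀ + w * p
    · -- regime `σ ≥ 1`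
      have h2b := ew_ge_of_sigma_ge_one hx (T ++ (w, p) :: M) (hall p hp0 hp1 hwp) (by rw [hσt]; linarith)
      have : x * min 1 σS[T ++ (w, p) :: M] ≤ x * 1 := mul_le_mul_of_nonneg_left (min_le_left _ _) hx.le
      linarith
    · push Not at hbig
      rw [hσt, min_eq_right (by linarith)]
      -- the affine function `h t = E W(t) − x (σ₀ + w t)` is `≥ 0` at `lo = x / w` and at `hi = min 1 ((1 − σ₀)/w)`
      set h : ℝ → ℝ := fun t => (EFS[T ++ (w, t) :: M, x]).1 - x * (σ₀ + w * t) with hh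
      have haff : ∃ α β : ℝ, ∀ t, h t = α + β * t := by
        obtain ⟨α, β, γ, δ, he⟩ := EFS_affine T M w x
        refine ⟨α - x * σ₀, β - x * w, fun t => ?_⟩
        simp only [hh, he t]
        ring
      have hlo : x / w ≤ p := by rw [div_le_iff₀ hw0]; linarith
      have hwlo : w * (x / w) = x := by field_simp
      -- value at `lo`: the item becomes tied, induction hypothesis with the longer frozen prefix
      have h_lo : 0 ≤ h (x / w) := by
        have hT' : ∀ l' ∈ T ++ [(w, x / w)], Adm[x, l'] ∧ (l'.1 * l'.2 = x ∨ l'.2 = 1) := by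
          intro l' hl'
          rw [List.mem_append, List.mem_singleton] at hl'
          rcases hl' with h' | rfl
          · exact hT l' h'
          · exact ⟨⟨div_nonneg hx.le hw0.le, by rw [div_le_one hw0]; exact hxw, hw1, by simp only [hwlo]; rfl⟩,
              Or.inl (by simp only [hwlo])⟩
        have := ih (T ++ [(w, x / w)]) hT' hM'
        rw [List.append_assoc, List.singleton_append, hσt, hwlo, min_eq_right (by linarith)] at this
        simp only [hh, hwlo]
        linarith
      -- value at `hi`
      have h_hi : 0 ≤ h (min 1 ((1 - σ₀) / w)) := by
        by_cases hc : (1 - σ₀) / w ≤ 1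
        · rw [min_eq_right hc]
          have hwhi : w * ((1 - σ₀) / w) = 1 - σ₀ := by field_simp
          have hhi0 : 0 ≤ (1 - σ₀) / w := div_nonneg (by nlinarith) hw0.le
          have h2b := ew_ge_of_sigma_ge_one hx (T ++ (w, (1 - σ₀) / w) :: M)
            (hall _ hhi0 hc (by rw [hwhi]; nlinarith)) (by rw [hσt, hwhi]; linarith)
          simp only [hh, hwhi]
          linarith
        · push Not at hc
          rw [min_eq_left hc.le]
          have hσ1 : σ₀ + w < 1 := by
            rw [lt_div_iff₀ hw0] at hc; linarith
          have hT' : ∀ l' ∈ T ++ [(w, 1)], Adm[x, l'] ∧ (l'.1 * l'.2 = x ∨ l'.2 = 1) := by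
            intro l' hl'
            rw [List.mem_append, List.mem_singleton] at hl'
            rcases hl' with h' | rfl
            · exact hT l' h'
            · exact ⟨⟨zero_le_one, le_rfl, hw1, by simp only [mul_one]; exact hxw⟩, Or.inr rfl⟩
          have := ih (T ++ [(w, 1)]) hT' hM'
          rw [List.append_assoc, List.singleton_append, hσt, mul_one, min_eq_right hσ1.le] at this
          simp only [hh, mul_one]
          linarith
      have hphi : p ≤ min 1 ((1 - σ₀) / w) := by
        refine le_min hp1 ?_
        rw [le_div_iff₀ hw0]; linarith
      have := affine_nonneg_of_endpoints haff hlo hphi h_lo h_hi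
      simp only [hh] at this
      linarith

/-- **THE SINGLES CHAIN LEMMA** (LEAD-NOTES-G7 N16/N17, Step 2c + Lemma T′ + regime 2b).  For a list of items `(w, p)` with
`0 ≤ p ≤ 1`, `w ≤ 1`, `x ≤ w p` (`x > 0`), occurring independently, the expected weight of the second occurring item in list order
(`x` if exactly one occurs, `0` if none) is at least `x · min(1, Σ w p)`. [this work] -/
theorem secondWeight_singles (hx : 0 < x) (L : List (ℝ × ℝ)) (hL : ∀ l ∈ L, Adm[x, l]) :
    x * min 1 σS[L] ≤ (EFS[L, x]).1 := by
  have := scl_aux hx L [] (by simp) hL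
  simpa only [List.nil_append] using this
end SecondWeight

end Quant

end Summit.CriticalPhenomena.PercolationContinuityZ3.Theorems
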